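import Summits.QuantumFields.YangMills.Theorems.AllWindowsColdBoxBoxHighWindowsSU22LineDefs

/-!
# T-U2.S — sharp Stage I («uniformised temporal gauge») for LINE-20 U2 (planner ym-idea-2 g17; STUB-PLAN-U2 rev 2 §3)

Typed task statement only (a `def … : Prop`, no theorem): on `ColdWall ∧ SmallPlaquettes s` with `s·H² ≤ c`, SOME interior gauge transform puts
every box link within defect-radius `C·H·s` (`InGaugeBall H (C·H·s) U`, i.e. `linkDefect ≤ C²·H²·s²` per link), versus the landed forest bound
`(12H²+2H+1)·s` (✓`linkDefect_forestFix_le`).  Consequence (STUB-PLAN-U2 §3.2): the Landau minimiser's total defect is `≤ 4(2H+1)⁴·C²H²s² ≤ C'·H⁶·s²`,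
and w5's one-step bootstrap ✓`landauBootstrapBound_of_landauKernelDecay` re-run with this `D` closes under exactly the premise of
`LandauRepresentativeBound` (U2).  Nothing is proved here; no crux, rung or summit is proved; the Yang–Mills mass gap is NOT proved.
-/

open Literature.MathematicalPhysics.QuantumFieldTheory
open Literature.MathematicalPhysics.QuantumFieldTheory.LatticeMaxwell
open Literature.MathematicalPhysics.QuantumFieldTheory.AxialGauge
open Summit.QuantumFields.YangMills.Theorems.WeakCouplingRates

namespace Summit.QuantumFields.YangMills.Theorems.AllWindowsColdBoxBoxHighLine

/-- **T-U2.S (uniform gauge bound, sharp Stage I).**  Proof sketch: temporal forest gauge (spatial links within `C·H·s`, interior temporal links `= 1`,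
bottom temporal links `((0,y),0)` carry the column holonomy `h_y`, `‖h_y − 1‖ ≲ H²s < 1/2`); then `g(x₀,y) := k_y^{2H−x₀}` with `k_y := h_y^{1/(2H)}`
makes every temporal link of column `y` equal to `k_y` (deviation `≤ C·H·s`) and moves spatial links by `‖h_y^t − h_{y+μ̂}^t‖ ≤ C‖h_y − h_{y+μ̂}‖ ≤ C'·H·s`. -/
def UniformGaugeBound : Prop :=
  ∃ C c : ℝ, 0 < C ∧ 0 < c ∧ ∀ H : ℕ, 1 ≤ H → ∀ s : ℝ, 0 ≤ s → s * (H : ℝ) ^ 2 ≤ c →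
    ∀ U : Literature.MathematicalPhysics.QuantumLattice.LGConfig 4 SU2, ColdWall H U → SmallPlaquettes H s U →
      InGaugeBall H (C * H * s) U

/-- The arithmetic consequence used by the bootstrap: a per-link radius `C·H·s` gives total defect `≤ 4(2H+1)⁴·(C·H·s)²` over the box links
(stated as a Prop to be proved together with `UniformGaugeBound`; `card (boxEdges 4 (2H+1)) ≤ 4(2H+1)⁴` is ✓`card_boxEdges_four_le`). -/
def SharpStageI : Prop :=
  ∃ C c : ℝ, 0 < C ∧ 0 < c ∧ ∀ H : ℕ, 1 ≤ H → ∀ s : ℝ, 0 ≤ s → s * (H : ℝ) ^ 2 ≤ c →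
    ∀ U : Literature.MathematicalPhysics.QuantumLattice.LGConfig 4 SU2, ColdWall H U → SmallPlaquettes H s U →
      ∃ g : Literature.Probability.LatticeModels.Site 4 → SU2, IsInteriorGauge H g ∧
        (∑ e ∈ boxEdges 4 (2 * H + 1), linkDefect (Literature.MathematicalPhysics.QuantumLattice.gaugeTransformZd g U) e) ≤
          C * (H : ℝ) ^ 6 * s ^ 2

end Summit.QuantumFields.YangMills.Theorems.AllWindowsColdBoxBoxHighLine
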